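import Mathlib

/-!
# The UNION LEMMA of mine-3's C-041.md §14 (c)–(d), at the abstract counting level (p6, gen 27)

Pure counting, no graphs.  Two finite state types `S₁`, `S₂` with predicates `valid`, `g₁` (`G₁`), `g₂` (`G₂`), the
`G`'s implying validity; the WEIGHT of a state is `[valid]·(3·[g₁] + 3·[g₂] − 2)` (`ocw`).  The PRODUCT `S₁ × S₂` carries
`valid = valid₁ ∨ valid₂`, `g_t = g_t¹ ∨ g_t²` (independent components: a red terminal edge or a good reach in either).

* `ocw_eq` — the weight is `3·[g₁] + 3·[g₂] − 2·[valid]`; the sum over a component is `3·X + 3·Y − 2·W` with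
  `X = #g₁`, `Y = #g₂`, `W = #valid` as sums of indicators (`sum_ocw`);
* `ind_or` — `[p ∨ q] = [p] + [q] − [p]·[q]`; the product sums (`sum_prod_ind_fst`, …);
* **`union_lemma`** — if each component has a nonnegative weighted sum, so does the product:
  `N₂·A₁ + N₁·A₂ − 3·X₁X₂ − 3·Y₁Y₂ + 2·W₁W₂ = (N₂ − W₂)·A₁ + (N₁ − W₁)·A₂ + W₁·A₂ + 3·X₁·(W₂ − X₂) + 3·Y₁·(W₂ − Y₂) ≥ 0`
  with `A_i = 3X_i + 3Y_i − 2W_i ≥ 0`, `X_i, Y_i ≤ W_i ≤ N_i` — the inequality behind mine-3's polytope-vertex check.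

This is the gluing step «ZONE O-CUBE for every zone ⟹ (O-CUBE) on a hub core» of §14 (c); the instance on the
abstract zones (`zoneOCube`) is not typed here.
-/

namespace PercRepro

namespace ZoneOCube

open Finset

/-- The indicator of a proposition, in `ℤ`. -/
noncomputable def ind (p : Prop) : ℤ := by classical exact if p then 1 else 0

/-- The indicator of a true proposition. -/
theorem ind_of_true {p : Prop} (h : p) : ind p = 1 := by
  unfold ind
  rw [if_pos h]

/-- The indicator of a false proposition. -/
theorem ind_of_false {p : Prop} (h : ¬ p) : ind p = 0 := by
  unfold ind
  rw [if_neg h]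

/-- Indicators are nonnegative. -/
theorem ind_nonneg (p : Prop) : 0 ≤ ind p := by
  by_cases h : p
  · rw [ind_of_true h]
    decide
  · rw [ind_of_false h]

/-- Indicators are at most one. -/
theorem ind_le_one (p : Prop) : ind p ≤ 1 := by
  by_cases h : p
  · rw [ind_of_true h]
  · rw [ind_of_false h]
    decide

/-- The indicator is monotone. -/
theorem ind_le_ind {p q : Prop} (h : p → q) : ind p ≤ ind q := by
  by_cases hp : p
  · rw [ind_of_true hp, ind_of_true (h hp)]
  · rw [ind_of_false hp]
    exact ind_nonneg q

/-- `[p ∨ q] = [p] + [q] − [p]·[q]`. -/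
theorem ind_or (p q : Prop) : ind (p ∨ q) = ind p + ind q - ind p * ind q := by
  by_cases hp : p <;> by_cases hq : q
  · rw [ind_of_true (Or.inl hp), ind_of_true hp, ind_of_true hq]
    ring
  · rw [ind_of_true (Or.inl hp), ind_of_true hp, ind_of_false hq]
    ring
  · rw [ind_of_true (Or.inr hq), ind_of_false hp, ind_of_true hq]
    ring
  · rw [ind_of_false (fun h => h.elim hp hq), ind_of_false hp, ind_of_false hq]
    ring

/-- The weight `[valid]·(3·[g₁] + 3·[g₂] − 2)` of a state. -/
noncomputable def ocw {S : Type*} (v g₁ g₂ : S → Prop) (σ : S) : ℤ :=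
  ind (v σ) * (3 * ind (g₁ σ) + 3 * ind (g₂ σ) - 2)

/-- When the `G`'s imply validity the weight is `3·[g₁] + 3·[g₂] − 2·[valid]`. -/
theorem ocw_eq {S : Type*} {v g₁ g₂ : S → Prop} (h₁ : ∀ σ, g₁ σ → v σ) (h₂ : ∀ σ, g₂ σ → v σ) (σ : S) :
    ocw v g₁ g₂ σ = 3 * ind (g₁ σ) + 3 * ind (g₂ σ) - 2 * ind (v σ) := by
  unfold ocw
  by_cases hv : v σ
  · rw [ind_of_true hv]
    ring
  · rw [ind_of_false hv, ind_of_false (fun h => hv (h₁ σ h)), ind_of_false (fun h => hv (h₂ σ h))]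
    ring

section Component

variable {S : Type*} [Fintype S]

/-- The sum of the weights over a component is `3·X + 3·Y − 2·W`. -/
theorem sum_ocw {v g₁ g₂ : S → Prop} (h₁ : ∀ σ, g₁ σ → v σ) (h₂ : ∀ σ, g₂ σ → v σ) :
    ∑ σ, ocw v g₁ g₂ σ = 3 * ∑ σ, ind (g₁ σ) + 3 * ∑ σ, ind (g₂ σ) - 2 * ∑ σ, ind (v σ) := by
  rw [Finset.mul_sum, Finset.mul_sum, Finset.mul_sum, ← Finset.sum_add_distrib, ← Finset.sum_sub_distrib]
  exact Finset.sum_congr rfl fun σ _ => ocw_eq h₁ h₂ σ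

/-- A sum of indicators is nonnegative. -/
theorem sum_ind_nonneg (p : S → Prop) : 0 ≤ ∑ σ, ind (p σ) :=
  Finset.sum_nonneg fun σ _ => ind_nonneg (p σ)

/-- A sum of indicators is at most the number of states. -/
theorem sum_ind_le_card (p : S → Prop) : ∑ σ, ind (p σ) ≤ Fintype.card S := by
  calc ∑ σ, ind (p σ) ≤ ∑ _σ : S, (1 : ℤ) := Finset.sum_le_sum fun σ _ => ind_le_one (p σ)
    _ = Fintype.card S := by simp

/-- Sums of indicators are monotone. -/
theorem sum_ind_le_sum_ind {p q : S → Prop} (h : ∀ σ, p σ → q σ) : ∑ σ, ind (p σ) ≤ ∑ σ, ind (q σ) :=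
  Finset.sum_le_sum fun σ _ => ind_le_ind (h σ)

end Component

section Product

variable {S₁ S₂ : Type*} [Fintype S₁] [Fintype S₂]

/-- A sum over the product of a function of the first coordinate. -/
theorem sum_prod_fst (f : S₁ → ℤ) : ∑ p : S₁ × S₂, f p.1 = Fintype.card S₂ * ∑ σ, f σ := by
  rw [Fintype.sum_prod_type, Finset.mul_sum]
  exact Finset.sum_congr rfl fun σ _ => by simp [mul_comm]

/-- A sum over the product of a function of the second coordinate. -/
theorem sum_prod_snd (f : S₂ → ℤ) : ∑ p : S₁ × S₂, f p.2 = Fintype.card S₁ * ∑ τ, f τ := by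
  rw [Fintype.sum_prod_type]
  simp [Finset.sum_const, Finset.card_univ]

/-- A sum over the product of a product of two coordinate functions. -/
theorem sum_prod_mul (f : S₁ → ℤ) (g : S₂ → ℤ) :
    ∑ p : S₁ × S₂, f p.1 * g p.2 = (∑ σ, f σ) * ∑ τ, g τ := by
  rw [Fintype.sum_prod_type, Finset.sum_mul]
  exact Finset.sum_congr rfl fun σ _ => by rw [Finset.mul_sum]

/-- The sum of `[p ∨ q]` over the product. -/
theorem sum_prod_ind_or (p : S₁ → Prop) (q : S₂ → Prop) :
    ∑ x : S₁ × S₂, ind (p x.1 ∨ q x.2) =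
      Fintype.card S₂ * ∑ σ, ind (p σ) + Fintype.card S₁ * ∑ τ, ind (q τ) - (∑ σ, ind (p σ)) * ∑ τ, ind (q τ) := by
  have : ∀ x : S₁ × S₂, ind (p x.1 ∨ q x.2) = ind (p x.1) + ind (q x.2) - ind (p x.1) * ind (q x.2) :=
    fun x => ind_or _ _
  rw [Finset.sum_congr rfl fun x _ => this x, Finset.sum_sub_distrib, Finset.sum_add_distrib,
    sum_prod_fst (fun σ => ind (p σ)), sum_prod_snd (fun τ => ind (q τ)),
    sum_prod_mul (fun σ => ind (p σ)) (fun τ => ind (q τ))]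

/-- **THE UNION LEMMA** (C-041.md §14 (c)–(d)): two independent components with nonnegative weighted sums (the `G`'s
implying validity) have a product with a nonnegative weighted sum, for `valid = ∨`, `g_t = ∨`. -/
theorem union_lemma {v₁ g₁ h₁ : S₁ → Prop} {v₂ g₂ h₂ : S₂ → Prop}
    (hg₁ : ∀ σ, g₁ σ → v₁ σ) (hh₁ : ∀ σ, h₁ σ → v₁ σ) (hg₂ : ∀ τ, g₂ τ → v₂ τ) (hh₂ : ∀ τ, h₂ τ → v₂ τ)
    (H₁ : 0 ≤ ∑ σ, ocw v₁ g₁ h₁ σ) (H₂ : 0 ≤ ∑ τ, ocw v₂ g₂ h₂ τ) :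
    0 ≤ ∑ x : S₁ × S₂, ocw (fun x => v₁ x.1 ∨ v₂ x.2) (fun x => g₁ x.1 ∨ g₂ x.2) (fun x => h₁ x.1 ∨ h₂ x.2) x := by
  have hgv : ∀ x : S₁ × S₂, (g₁ x.1 ∨ g₂ x.2) → (v₁ x.1 ∨ v₂ x.2) := fun x h => h.imp (hg₁ x.1) (hg₂ x.2)
  have hhv : ∀ x : S₁ × S₂, (h₁ x.1 ∨ h₂ x.2) → (v₁ x.1 ∨ v₂ x.2) := fun x h => h.imp (hh₁ x.1) (hh₂ x.2)
  rw [sum_ocw hgv hhv, sum_prod_ind_or, sum_prod_ind_or, sum_prod_ind_or]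
  rw [sum_ocw hg₁ hh₁] at H₁
  rw [sum_ocw hg₂ hh₂] at H₂
  set N₁ : ℤ := (Fintype.card S₁ : ℤ)
  set N₂ : ℤ := (Fintype.card S₂ : ℤ)
  set X₁ := ∑ σ, ind (g₁ σ)
  set Y₁ := ∑ σ, ind (h₁ σ)
  set W₁ := ∑ σ, ind (v₁ σ)
  set X₂ := ∑ τ, ind (g₂ τ)
  set Y₂ := ∑ τ, ind (h₂ τ)
  set W₂ := ∑ τ, ind (v₂ τ)
  have hX₁ : X₁ ≤ W₁ := sum_ind_le_sum_ind hg₁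
  have hY₁ : Y₁ ≤ W₁ := sum_ind_le_sum_ind hh₁
  have hX₂ : X₂ ≤ W₂ := sum_ind_le_sum_ind hg₂
  have hY₂ : Y₂ ≤ W₂ := sum_ind_le_sum_ind hh₂
  have hW₁ : W₁ ≤ N₁ := sum_ind_le_card v₁
  have hW₂ : W₂ ≤ N₂ := sum_ind_le_card v₂
  have hX₁0 : 0 ≤ X₁ := sum_ind_nonneg g₁
  have hY₁0 : 0 ≤ Y₁ := sum_ind_nonneg h₁
  have hW₁0 : 0 ≤ W₁ := sum_ind_nonneg v₁
  have key : 3 * (N₂ * X₁ + N₁ * X₂ - X₁ * X₂) + 3 * (N₂ * Y₁ + N₁ * Y₂ - Y₁ * Y₂) -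
      2 * (N₂ * W₁ + N₁ * W₂ - W₁ * W₂) =
      (N₂ - W₂) * (3 * X₁ + 3 * Y₁ - 2 * W₁) + (N₁ - W₁) * (3 * X₂ + 3 * Y₂ - 2 * W₂) +
        W₁ * (3 * X₂ + 3 * Y₂ - 2 * W₂) + 3 * X₁ * (W₂ - X₂) + 3 * Y₁ * (W₂ - Y₂) := by ring
  rw [key]
  have t1 : 0 ≤ (N₂ - W₂) * (3 * X₁ + 3 * Y₁ - 2 * W₁) := mul_nonneg (by linarith) H₁
  have t2 : 0 ≤ (N₁ - W₁) * (3 * X₂ + 3 * Y₂ - 2 * W₂) := mul_nonneg (by linarith) H₂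
  have t3 : 0 ≤ W₁ * (3 * X₂ + 3 * Y₂ - 2 * W₂) := mul_nonneg hW₁0 H₂
  have t4 : 0 ≤ 3 * X₁ * (W₂ - X₂) := mul_nonneg (by linarith) (by linarith)
  have t5 : 0 ≤ 3 * Y₁ * (W₂ - Y₂) := mul_nonneg (by linarith) (by linarith)
  linarith

end Product

end ZoneOCube

end PercRepro
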